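import Literature.InformationTheory.QuantumCodes.HypergraphProductKernels
import Literature.InformationTheory.Coding.TensorCodeDimension

/-!
# Hypergraph product: the dimension theorem (Tillich–Zémor, Thm 7) — proof

We prove `HypergraphProduct.dimension_eq` (Tillich–Zémor 2014, Theorem 7 as printed,
`Literature.InformationTheory.QuantumCodes.HypergraphProduct`; held text arXiv:0903.0566v1 chunk p0007
L96-135) [TillichZemor2014]:
`dim Q_ℋ = 2rs + r(|E₂| − |V₂|) + s(|E₁| − |V₁|) = 2kh + k(|V₂| − |E₂|) + h(|V₁| − |E₁|)`.

Route (the paper's, Props. 5–6): the linear relations among the rows of `H_Z` (chambers) form a space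
isomorphic to the tensor code `Z(ℋ₁) ⊗ Z(ℋ₂)` (dimension `kh`, `TensorCode.finrank_tensorCode`), so
`dim C_Z^⊥ = rank H_Z = |E₁||E₂| − kh` (Prop. 5); dually `rank H_X = |V₁||V₂| − rs` (Prop. 6, via Poincaré
duality Prop. 2); then `dim Q = |E| − rank H_X − rank H_Z` and rank–nullity `k − r = |E₁| − |V₁|`,
`h − s = |E₂| − |V₂|` (eq. (1)) give both printed forms. In matrix language the row relations of
`[A ⊗ 1 | 1 ⊗ B]` are the matrices `G` with `Aᵀ G = 0` and `G B = 0`, i.e. the tensor code of `ker Aᵀ` and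
`ker Bᵀ` (`finrank_ker_transpose_fromCols_kronecker`).
-/

namespace Literature.InformationTheory.QuantumCodes

open Matrix Module
open scoped Kronecker

/-! ### Rank and left kernel -/

section LeftKernel

variable {F : Type*} [Field F]
variable {ρ q q' : Type*} [Fintype ρ] [Fintype q] [Fintype q']

/-- Rank–nullity on the row side: `rank P + dim {g | g P = 0} = #rows`. [folklore] -/
private theorem rank_add_finrank_ker_transpose (P : Matrix ρ q F) :
    P.rank + finrank F (LinearMap.ker Pᵀ.mulVecLin) = Fintype.card ρ := by
  rw [← Matrix.rank_transpose P, Matrix.rank, LinearMap.finrank_range_add_finrank_ker]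
  exact Module.finrank_fintype_fun_eq_card F

omit [Fintype q] [Fintype q'] in
/-- Re-indexing the columns does not change the space of row relations. [folklore] -/
private theorem ker_transpose_submatrix (P : Matrix ρ q F) (σ : q' ≃ q) :
    LinearMap.ker (P.submatrix id σ)ᵀ.mulVecLin = LinearMap.ker Pᵀ.mulVecLin := by
  ext g
  simp only [LinearMap.mem_ker, Matrix.mulVecLin_apply, funext_iff, Pi.zero_apply]
  exact σ.forall_congr (fun {i} => Iff.rfl)

end LeftKernel

/-! ### Row relations of `[A ⊗ 1 | 1 ⊗ B]` -/

section RowRelations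

variable {F : Type*} [Field F]
variable {V₁ E₁ V₂ E₂ : Type*}
variable [Fintype V₁] [Fintype E₁] [Fintype V₂] [Fintype E₂]
variable [DecidableEq V₁] [DecidableEq E₁] [DecidableEq V₂] [DecidableEq E₂]

omit [Fintype E₁] [Fintype E₂] [DecidableEq E₁] [DecidableEq E₂] in
/-- The row relations `g` of the block matrix `[A ⊗ 1 | 1 ⊗ B]` (`g [A ⊗ 1 | 1 ⊗ B] = 0`), read as
`V₁ × V₂` matrices `G`, are exactly the matrices with every column in `ker Aᵀ` and every row in `ker Bᵀ`:
the tensor code `ker Aᵀ ⊗ ker Bᵀ`; hence their dimension is `dim ker Aᵀ · dim ker Bᵀ`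
(TZ Props. 5/6: "a vector space isomorphic to the product code `Z(ℋ₁) ⊗ Z(ℋ₂)`").
[cite: TillichZemor2014, Prop. 5 and Prop. 6 (arXiv v1 chunk p0007 L66-113)] -/
theorem finrank_ker_transpose_fromCols_kronecker (A : Matrix V₁ E₁ F) (B : Matrix V₂ E₂ F) :
    finrank F (LinearMap.ker
        (Matrix.fromCols (A ⊗ₖ (1 : Matrix V₂ V₂ F)) ((1 : Matrix V₁ V₁ F) ⊗ₖ B))ᵀ.mulVecLin)
      = finrank F (pcCode Aᵀ) * finrank F (pcCode Bᵀ) := by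
  set P := Matrix.fromCols (A ⊗ₖ (1 : Matrix V₂ V₂ F)) ((1 : Matrix V₁ V₁ F) ⊗ₖ B) with hP
  let e : (V₁ × V₂ → F) ≃ₗ[F] Matrix V₁ V₂ F :=
    (LinearEquiv.curry F F V₁ V₂).trans (Matrix.ofLinearEquiv F)
  have hmap : Submodule.map (e : (V₁ × V₂ → F) →ₗ[F] Matrix V₁ V₂ F) (LinearMap.ker Pᵀ.mulVecLin)
      = Coding.TensorCode.tensorCode (pcCode Aᵀ) (pcCode Bᵀ) := by
    ext M
    rw [Submodule.mem_map_equiv, Coding.TensorCode.mem_tensorCode_iff, LinearMap.mem_ker,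
      Matrix.mulVecLin_apply, Matrix.mulVec_transpose, hP, Matrix.vecMul_fromCols]
    simp only [funext_iff, Sum.forall, Sum.elim_inl, Sum.elim_inr, Pi.zero_apply, Prod.forall,
      vecMul_kronecker_one_apply, vecMul_one_kronecker_apply, mem_pcCode_iff]
    have he : ∀ a b, e.symm M (a, b) = M a b := fun a b => rfl
    simp only [he]
    constructor
    · rintro ⟨hA, hB⟩
      refine ⟨fun b α => ?_, fun a β => ?_⟩
      · simpa [Matrix.mulVec, dotProduct] using hA α b
      · rw [Matrix.mulVec_transpose]
        simpa [Matrix.vecMul, dotProduct] using hB a β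
    · rintro ⟨hA, hB⟩
      refine ⟨fun α b => ?_, fun a β => ?_⟩
      · simpa [Matrix.mulVec, dotProduct] using hA b α
      · have h := hB a β
        rw [Matrix.mulVec_transpose] at h
        simpa [Matrix.vecMul, dotProduct] using h
  rw [← Coding.TensorCode.finrank_tensorCode, ← hmap, LinearEquiv.finrank_map_eq]

end RowRelations

/-! ### Theorem 7 -/

namespace HypergraphProduct

variable {V₁ E₁ V₂ E₂ : Type*}
variable [Fintype V₁] [Fintype E₁] [Fintype V₂] [Fintype E₂]
variable [DecidableEq V₁] [DecidableEq E₁] [DecidableEq V₂] [DecidableEq E₂]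

omit [DecidableEq E₁] [DecidableEq E₂] in
/-- **TZ Proposition 6** in rank form: `rank H_X + rs = |V₁||V₂|`, where `r = dim Z(ℋ₁ᵀ) = dim ker H₁ᵀ`,
`s = dim Z(ℋ₂ᵀ) = dim ker H₂ᵀ` (`dim C_X^⊥ = |V₁||V₂| − rs`). Proved.
[cite: TillichZemor2014, Prop. 6 (arXiv v1 chunk p0007 L106-113)] -/
theorem rank_xMatrix_add (H₁ : Matrix V₁ E₁ (ZMod 2)) (H₂ : Matrix V₂ E₂ (ZMod 2)) :
    (xMatrix H₁ H₂).rank + finrank (ZMod 2) (pcCode H₁ᵀ) * finrank (ZMod 2) (pcCode H₂ᵀ)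
      = Fintype.card V₁ * Fintype.card V₂ := by
  rw [← finrank_ker_transpose_fromCols_kronecker H₁ H₂, ← Fintype.card_prod]
  exact rank_add_finrank_ker_transpose (xMatrix H₁ H₂)

omit [DecidableEq V₁] [DecidableEq V₂] in
/-- **TZ Proposition 5** in rank form: `rank H_Z + kh = |E₁||E₂|`, where `k = dim Z(ℋ₁) = dim ker H₁`,
`h = dim Z(ℋ₂) = dim ker H₂` ("the dimension of the chamber code `C_Z^⊥` equals `|E₁||E₂| − kh`").
Proved (from Prop. 6 for the dual hypergraph, Prop. 2). [cite: TillichZemor2014, Prop. 5 (arXiv v1 chunk p0007 L66-101)] -/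
theorem rank_zMatrix_add (H₁ : Matrix V₁ E₁ (ZMod 2)) (H₂ : Matrix V₂ E₂ (ZMod 2)) :
    (zMatrix H₁ H₂).rank + finrank (ZMod 2) (pcCode H₁) * finrank (ZMod 2) (pcCode H₂)
      = Fintype.card E₁ * Fintype.card E₂ := by
  have hker : finrank (ZMod 2) (LinearMap.ker (zMatrix H₁ H₂)ᵀ.mulVecLin)
      = finrank (ZMod 2) (pcCode H₁) * finrank (ZMod 2) (pcCode H₂) := by
    rw [zMatrix_eq_submatrix_swap,
      show (Sum.swap : (E₁ × V₂) ⊕ (V₁ × E₂) → (V₁ × E₂) ⊕ (E₁ × V₂)) = swapEquiv V₁ E₁ V₂ E₂ from rfl,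
      ker_transpose_submatrix, xMatrix, finrank_ker_transpose_fromCols_kronecker,
      Matrix.transpose_transpose, Matrix.transpose_transpose]
  rw [← hker, ← Fintype.card_prod]
  exact rank_add_finrank_ker_transpose (zMatrix H₁ H₂)

omit [DecidableEq V₁] [DecidableEq E₁] in
/-- Rank–nullity for a parity-check matrix: `rank H + dim ker H = #columns`, i.e. TZ eq. (1)
`dim Z(ℋᵀ) = |V| − dim Z(ℋ)^⊥` read for `Hᵀ` (`dim Z(ℋ)^⊥ = rank H`).
[cite: TillichZemor2014, §3 eq. (1) (arXiv v1 chunk p0006 L48-52)] -/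
theorem rank_add_finrank_pcCode {V E : Type*} [Fintype V] [Fintype E]
    (H : Matrix V E (ZMod 2)) : H.rank + finrank (ZMod 2) (pcCode H) = Fintype.card E := by
  rw [Matrix.rank, pcCode, LinearMap.finrank_range_add_finrank_ker]
  exact Module.finrank_fintype_fun_eq_card (ZMod 2)

/-- **Tillich–Zémor Theorem 7 (dimension of the hypergraph-product code), proved**: discharges the named
fact `HypergraphProduct.dimension_eq` — both printed forms
`dim Q_ℋ = 2rs + r(|E₂| − |V₂|) + s(|E₁| − |V₁|) = 2kh + k(|V₂| − |E₂|) + h(|V₁| − |E₁|)` with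
`dim Q_ℋ = |E| − rank H_X − rank H_Z`. [cite: TillichZemor2014, Thm 7 (arXiv v1 chunk p0007 L126-135)] -/
theorem dimension_eq_holds : dimension_eq := by
  intro V₁ E₁ V₂ E₂ _ _ _ _ _ _ _ _ H₁ H₂
  dsimp only
  have hX := congrArg (Nat.cast : ℕ → ℤ) (rank_xMatrix_add H₁ H₂)
  have hZ := congrArg (Nat.cast : ℕ → ℤ) (rank_zMatrix_add H₁ H₂)
  have h1 := congrArg (Nat.cast : ℕ → ℤ) (rank_add_finrank_pcCode H₁)
  have h1t := congrArg (Nat.cast : ℕ → ℤ) (rank_add_finrank_pcCode H₁ᵀ)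
  have h2 := congrArg (Nat.cast : ℕ → ℤ) (rank_add_finrank_pcCode H₂)
  have h2t := congrArg (Nat.cast : ℕ → ℤ) (rank_add_finrank_pcCode H₂ᵀ)
  rw [Matrix.rank_transpose] at h1t h2t
  push_cast at hX hZ h1 h1t h2 h2t
  have hcard : (Fintype.card ((E₁ × V₂) ⊕ (V₁ × E₂)) : ℤ)
      = Fintype.card E₁ * Fintype.card V₂ + Fintype.card V₁ * Fintype.card E₂ := by
    rw [Fintype.card_sum, Fintype.card_prod, Fintype.card_prod]; push_cast; ring
  constructor
  · linear_combination hcard - hX - hZ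
      + (Module.finrank (ZMod 2) (pcCode H₂) : ℤ) * (h1 - h1t)
      + ((Module.finrank (ZMod 2) (pcCode H₁ᵀ) : ℤ) + Fintype.card E₁ - Fintype.card V₁) * (h2 - h2t)
  · linear_combination hcard - hX - hZ
      + (Module.finrank (ZMod 2) (pcCode H₂ᵀ) : ℤ) * (h1t - h1)
      + ((Module.finrank (ZMod 2) (pcCode H₁) : ℤ) + Fintype.card V₁ - Fintype.card E₁) * (h2t - h2)

end HypergraphProduct

end Literature.InformationTheory.QuantumCodes
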